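import Mathlib.RingTheory.Etale.Field
import Mathlib.RingTheory.Smooth.Basic
import Mathlib.RingTheory.Trace.Basic
import Mathlib.LinearAlgebra.Trace
import HarnessLib

/-!
# The trace form of a finite algebra modulo a nilpotent ideal with separable residue field:
# `Tr_{R/κ}(y) = (dim_κ R/[k:κ]) · Tr_{k/κ}(ȳ)`

Topic `Literature/RingTheory/CompleteLocalRings` (companion of `CoefficientField.lean`, Cohen's
coefficient fields). Let `κ` be a field, `R` a finite commutative `κ`-algebra and `N ⊂ R` a
nilpotent maximal ideal with residue field `k = R ⧸ N` SEPARABLE over `κ` (so `R` is a local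
Artinian `κ`-algebra; the case in view is `R = B ⧸ 𝔓^e`, `N = 𝔓/𝔓^e`, `κ = A/𝔭` for a prime
`𝔓 ∣ 𝔭` of ramification index `e` in an extension of Dedekind domains, where
`dim_κ R = n_𝔓 = Σ_{i<e} [𝔓ⁱ/𝔓ⁱ⁺¹ : A/𝔭] = e_𝔓 f_𝔓`, Serre, *Corps locaux*, Ch. I §5). We prove:

* `exists_algHom_section` — **a `κ`-algebra coefficient field**: the projection `R → k` has a
  `κ`-algebra section `σ` (separable extensions are formally étale, Mathlib's
  `Algebra.FormallyEtale.of_isSeparable`, and formally smooth algebras lift against nilpotent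
  ideals, `Algebra.FormallySmooth.exists_lift`; Cohen's theorem `CoefficientField.lean` gives a
  ring section without the `κ`-linearity, which needs separability);
* `finrank_eq_mul_and_trace_eq` — **`dim_κ R = c · [k : κ]` and `Tr_{R/κ}(y) = c · Tr_{k/κ}(ȳ)`**
  for every `y ∈ R`, with `c = dim_k R` (`R` a `k`-vector space through `σ`): `y - σ(ȳ)` is
  nilpotent, hence of trace zero (`trace_eq_zero_of_isNilpotent`), and
  `Tr_{R/κ} ∘ σ = Tr_{k/κ} ∘ Tr_{R/k} ∘ σ = c · Tr_{k/κ}` (Mathlib's `Algebra.trace_trace`,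
  `Algebra.trace_algebraMap`);
* `trace_eq_zero_iff`, `exists_trace_ne_zero` — **the trace form of `R/κ` vanishes identically iff
  `c = 0` in `κ`** (the trace form of the separable `k/κ` is non-zero, `Algebra.trace_ne_zero`).

This is the algebra behind the tame/wild dichotomy for the different (Serre, *Corps locaux*,
Ch. III §6 Prop. 13; `Literature/NumberTheory/NumberFields/DifferentTameRamification.lean`).
Theorems only; no definition, no named fact.

## References

* J.-P. Serre, *Local Fields* (Corps locaux), GTM 67, Springer (1979): Ch. I §5 (`n_𝔓 = e_𝔓 f_𝔓`),
  Ch. III §6 Prop. 13. [Serre1979]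
* H. Matsumura, *Commutative Ring Theory*, CUP (1986), §28 (coefficient fields). [Matsumura1987]
-/

noncomputable section

namespace Literature.RingTheory.CompleteLocalRings

variable {κ R : Type*} [Field κ] [CommRing R] [Algebra κ R] [Module.Finite κ R]
  (N : Ideal R)

omit [Module.Finite κ R] in
/-- **A `κ`-algebra coefficient field.** If `N` is a nilpotent ideal of the `κ`-algebra `R` with
`R ⧸ N` a separable field extension of `κ`, the projection `R → R ⧸ N` has a `κ`-algebra section
(formal smoothness of separable extensions, Mathlib's `Algebra.FormallyEtale.of_isSeparable` and
`Algebra.FormallySmooth.exists_lift`; a `κ`-linear refinement of Cohen's coefficient field,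
`CoefficientField.lean`). [folklore] -/
theorem exists_algHom_section [N.IsMaximal] (hN : IsNilpotent N)
    [Algebra.IsSeparable κ (R ⧸ N)] :
    ∃ σ : (R ⧸ N) →ₐ[κ] R, ∀ x, Ideal.Quotient.mk N (σ x) = x := by
  letI : Field (R ⧸ N) := Ideal.Quotient.field N
  haveI : Algebra.FormallyEtale κ (R ⧸ N) := Algebra.FormallyEtale.of_isSeparable κ (R ⧸ N)
  obtain ⟨σ, hσ⟩ :=
    Algebra.FormallySmooth.exists_lift (R := κ) (A := R ⧸ N) N hN (AlgHom.id κ (R ⧸ N))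
  exact ⟨σ, fun x ↦ by simpa using AlgHom.congr_fun hσ x⟩

omit [Module.Finite κ R] in
/-- The trace of a nilpotent element of an algebra over a field vanishes. [folklore] -/
theorem trace_eq_zero_of_isNilpotent {y : R} (hy : IsNilpotent y) : Algebra.trace κ R y = 0 := by
  have h : IsNilpotent (Algebra.trace κ R y) := by
    rw [Algebra.trace_apply]
    exact LinearMap.isNilpotent_trace_of_isNilpotent
      ((LinearMap.isNilpotent_mulLeft_iff κ y).mpr hy)
  exact h.eq_zero

/-- **The trace modulo a nilpotent ideal with separable residue field.** Let `R` be a finite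
commutative `κ`-algebra and `N` a nilpotent maximal ideal with `k = R ⧸ N` separable over `κ`
(so `R` is local Artinian). Then `dim_κ R = c · [k : κ]` for `c = dim_k R` (computed through any
`κ`-algebra coefficient field) and, for every `y ∈ R`,
**`Tr_{R/κ}(y) = c · Tr_{k/κ}(ȳ)`** — the trace factors through the associated graded
`⊕ Nⁱ/Nⁱ⁺¹`, a `k`-vector space of dimension `c` (cf. Serre, *Corps locaux* I §5,
"`n_𝔓 = Σ [𝔓ⁱ/𝔓ⁱ⁺¹ : A/𝔭] = e_𝔓 f_𝔓`", for `R = B/𝔓^{e}`). [folklore] -/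
theorem finrank_eq_mul_and_trace_eq [N.IsMaximal] (hN : IsNilpotent N)
    [Algebra.IsSeparable κ (R ⧸ N)] :
    ∃ c : ℕ, Module.finrank κ R = c * Module.finrank κ (R ⧸ N) ∧
      ∀ y : R, Algebra.trace κ R y = c • Algebra.trace κ (R ⧸ N) (Ideal.Quotient.mk N y) := by
  letI : Field (R ⧸ N) := Ideal.Quotient.field N
  obtain ⟨σ, hσ⟩ := exists_algHom_section (κ := κ) N hN
  -- `R` as an algebra over `k = R ⧸ N` through the section `σ`
  letI alg : Algebra (R ⧸ N) R := σ.toRingHom.toAlgebra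
  haveI : IsScalarTower κ (R ⧸ N) R :=
    IsScalarTower.of_algebraMap_eq fun x ↦ (σ.commutes x).symm
  haveI : Module.Finite (R ⧸ N) R := Module.Finite.of_restrictScalars_finite κ _ _
  refine ⟨Module.finrank (R ⧸ N) R, ?_, fun y ↦ ?_⟩
  · rw [mul_comm, Module.finrank_mul_finrank]
  · -- `y = σ ȳ + n` with `n ∈ N` nilpotent
    have hn : y - σ (Ideal.Quotient.mk N y) ∈ N := by
      rw [← Ideal.Quotient.eq_zero_iff_mem, map_sub, hσ, sub_self]
    have hnil : IsNilpotent (y - σ (Ideal.Quotient.mk N y)) := by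
      obtain ⟨n, hn0⟩ := hN
      exact ⟨n, by
        have := Ideal.pow_mem_pow hn n
        rw [hn0] at this
        exact (Submodule.mem_bot R).mp this⟩
    have key : Algebra.trace κ R (σ (Ideal.Quotient.mk N y)) =
        Module.finrank (R ⧸ N) R • Algebra.trace κ (R ⧸ N) (Ideal.Quotient.mk N y) := by
      change Algebra.trace κ R (algebraMap (R ⧸ N) R (Ideal.Quotient.mk N y)) = _
      rw [← Algebra.trace_trace (S := R ⧸ N), Algebra.trace_algebraMap, map_nsmul]
    have hsplit : y = σ (Ideal.Quotient.mk N y) + (y - σ (Ideal.Quotient.mk N y)) := by ring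
    conv_lhs => rw [hsplit]
    rw [map_add, trace_eq_zero_of_isNilpotent hnil, add_zero, key]

/-- Hence **the trace form of `R/κ` vanishes identically iff `c = dim_κ R/[k:κ]` is zero in `κ`**
(the trace form of the separable `k/κ` being non-zero). [folklore] -/
theorem trace_eq_zero_iff [N.IsMaximal] (hN : IsNilpotent N) [Algebra.IsSeparable κ (R ⧸ N)] :
    Algebra.trace κ R = 0 ↔
      ((Module.finrank κ R / Module.finrank κ (R ⧸ N) : ℕ) : κ) = 0 := by
  letI : Field (R ⧸ N) := Ideal.Quotient.field N
  obtain ⟨c, hc, htr⟩ := finrank_eq_mul_and_trace_eq (κ := κ) N hN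
  haveI : FiniteDimensional κ (R ⧸ N) := inferInstance
  have hf : 0 < Module.finrank κ (R ⧸ N) := Module.finrank_pos
  have hcdiv : Module.finrank κ R / Module.finrank κ (R ⧸ N) = c := by
    rw [hc, Nat.mul_div_cancel _ hf]
  rw [hcdiv]
  constructor
  · intro h0
    -- the trace form of `k/κ` is non-zero: pick `x̄` with `Tr(x̄) ≠ 0`
    obtain ⟨x, hx⟩ : ∃ x : R ⧸ N, Algebra.trace κ (R ⧸ N) x ≠ 0 := by
      simpa [LinearMap.ext_iff] using Algebra.trace_ne_zero κ (R ⧸ N)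
    obtain ⟨y, rfl⟩ := Ideal.Quotient.mk_surjective x
    have h := htr y
    rw [h0, LinearMap.zero_apply, nsmul_eq_mul] at h
    exact (mul_eq_zero.mp h.symm).resolve_right hx
  · intro h0
    ext y
    rw [htr y, LinearMap.zero_apply, nsmul_eq_mul, h0, zero_mul]

/-- In particular there is an element of non-zero trace as soon as `c ≠ 0` in `κ`. [folklore] -/
theorem exists_trace_ne_zero [N.IsMaximal] (hN : IsNilpotent N) [Algebra.IsSeparable κ (R ⧸ N)]
    (hc : ((Module.finrank κ R / Module.finrank κ (R ⧸ N) : ℕ) : κ) ≠ 0) :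
    ∃ y : R, Algebra.trace κ R y ≠ 0 := by
  by_contra h
  push Not at h
  exact hc ((trace_eq_zero_iff (κ := κ) N hN).mp (LinearMap.ext h))

end Literature.RingTheory.CompleteLocalRings

end
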